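import Mathlib
import Literature.MathematicalPhysics.QuantumFieldTheory.Balaban1983to89.B9Thm314ResolventCore

/-!
# `Balaban1983to89.B9Thm314ResolventWeighted` — [Balaban1985BackgroundPropagators] Theorem 3.14 (pp. 426–427, (3.154)) by the RESOLVENT ROUTE WITH SCALE
# WEIGHTS: the engine of `B9Thm314ResolventCore` with the prefactors of (3.42) ∕ (3.48) carried — output weight `w₁(y)` of the left propagator, input weight `r(y′)`
# of the right one, and the middle weights `u(y₁)·w₂(y₂)` (averaging operator × right propagator) moved to the output block by ONE transfer hypothesis of [4] (2.60)
# shape; constants of the inputs only (hence M-uniform when they are)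

B9 = T. Bałaban, *Propagators for lattice gauge theories in a background field*, Commun. Math. Phys. **99** (1985) 389–434 [Balaban1985BackgroundPropagators];
[4] = [Balaban1984PropagatorsII]: (2.51)–(2.55) p. 232, (2.60)–(2.61) p. 234, and p. 235 *"we may change it … using the exponential factor e^{−¼δ₀d(y,y′)} and the
estimate (2.60)"* (the weight transfer), p. 398 of B9 *"Using Lemma 2.1 in [4] we may replace the factor (Lʲη)^α by (Lʲη)^β(L^{j′}η)^γ with β + γ = α"*.

WHY (DAG node N06, seat `pub-ymgap-dag-n06-a`; typed-leaf flag t314 part (ii)): `B9Thm314ResolventCore.hasMajorant_resolvent_core` is prefactor-free; the characteristic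
inequalities (3.42) carry scale weights ((Lʲη)², Lʲη, … at the OUTPUT block; (3.48)-type kernels also (L^{j′}η)^{−d} at the INPUT block), and the middle factor
Δ′_a[D′] − Δ′_a[D] carries the weights of the (3.24) averaging terms.  This file carries them: the left weight `w₁` and the right input weight `r` factor out; the middle
product `u(y₁)w₂(y₂)` is moved to a weight `W(y)` at the output block at the price `Λ` and half the rate, through the single displayed hypothesis
`u(y₁)·w₂(y₂)·e^{−(δ/2)d(y,y₁)}·e^{−(δ/2)d(y₁,y₂)} ≤ Λ·W(y)` — at Bałaban's objects an instance of (2.60) (scales along the chain differ by at most d/(RM) + 1 per link;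
`B9Thm314GpFlatResolvent.transfer_top`, `B9Ineq347.ScaleTransfer`).

WHAT IS PROVED (kernel; no `sorry`; every analytic input displayed): `hasMajorant_resolvent_weighted` — with `K₁ ≤ C₁w₁(y)e^{−δd}`, `0 ≤ K_V ≤ v·u(y₁)e^{−2δd(y₁,y₂)}` vanishing
for `y₁ ∉ S`, `0 ≤ K₂ ≤ C₂w₂(y₂)r(y′)e^{−δd}`, the transfer hypothesis, (2.54), `d ≥ 0`, (2.61) at the rate δ/6 and `F ≤` the `S`-detour distance: `T₁VT₂` has majorant
`C₁vC₂Λc²·w₁(y)W(y)r(y′)·e^{−(δ/6)d(y,y′)}·e^{−(δ/6)F(y,y′)}`; `hasMajorant_inv_sub_inv_weighted` — the same for `T₁ − T₂` via the resolvent identity.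
HONEST SCOPE: one block structure (the second family's majorant re-blocked beforehand); sup-type block majorants; count-neutral; NOT continuum ∕ Clay.
-/

namespace Literature.MathematicalPhysics.QuantumFieldTheory.Balaban1983to89.B9Thm314ResolventWeighted

open Finset
open Literature.MathematicalPhysics.QuantumFieldTheory.Balaban1983to89.B6RandomWalk (HasMajorant hasMajorant_mono hasMajorant_mul Triangle254)
open Literature.MathematicalPhysics.QuantumFieldTheory.Balaban1983to89.B9Thm314ResolventCore (sub_eq_mul_sub_mul hasMajorant_mul₃)

section Weighted

variable {g : B6.Geometry} {X : Type}

/-- (2.61) at a weaker rate dominates the sum at a stronger one (for `d ≥ 0`). [cite: Balaban1984PropagatorsII, Lemma 2.1 (2.61) p.234 (bookkeeping)] -/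
private theorem sum_exp_le_of_rate {σ δ c : ℝ} (hσδ : σ ≤ δ) (hd : ∀ a b : g.Site, 0 ≤ g.dist a b)
    (hsum : ∀ y : g.Site, ∑ y' : g.Site, Real.exp (-(σ * g.dist y y')) ≤ c) (y : g.Site) :
    ∑ y' : g.Site, Real.exp (-(δ * g.dist y y')) ≤ c := by
  refine le_trans (Finset.sum_le_sum fun y' _ => ?_) (hsum y)
  exact Real.exp_le_exp.2 (neg_le_neg (mul_le_mul_of_nonneg_right hσδ (hd y y')))

/-- The inner summation: `Σ_{y₂} e^{−(3δ/2)d(y₁,y₂)}e^{−δd(y₂,b)} ≤ c·e^{−δd(y₁,b)}` ((2.54) + (2.61) at any rate ≤ δ/2). [cite: Balaban1984PropagatorsII, (2.54)–(2.55) pp.232–233 (bookkeeping)] -/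
private theorem inner_sum_le {δ c : ℝ} (hδ : 0 ≤ δ) (hd : ∀ a b : g.Site, 0 ≤ g.dist a b) (htri : Triangle254 g)
    (hsum : ∀ y : g.Site, ∑ y' : g.Site, Real.exp (-(δ / 6 * g.dist y y')) ≤ c) (y₁ b : g.Site) :
    ∑ y₂ : g.Site, Real.exp (-(3 * δ / 2 * g.dist y₁ y₂)) * Real.exp (-(δ * g.dist y₂ b)) ≤
      c * Real.exp (-(δ * g.dist y₁ b)) := by
  have hterm : ∀ y₂ : g.Site, Real.exp (-(3 * δ / 2 * g.dist y₁ y₂)) * Real.exp (-(δ * g.dist y₂ b)) ≤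
      Real.exp (-(δ / 2 * g.dist y₁ y₂)) * Real.exp (-(δ * g.dist y₁ b)) := by
    intro y₂
    rw [← Real.exp_add, ← Real.exp_add]
    apply Real.exp_le_exp.2
    have h3 := mul_le_mul_of_nonneg_left (htri y₁ y₂ b) hδ
    nlinarith [hd y₁ y₂]
  calc ∑ y₂ : g.Site, Real.exp (-(3 * δ / 2 * g.dist y₁ y₂)) * Real.exp (-(δ * g.dist y₂ b))
      ≤ ∑ y₂ : g.Site, Real.exp (-(δ / 2 * g.dist y₁ y₂)) * Real.exp (-(δ * g.dist y₁ b)) := Finset.sum_le_sum fun y₂ _ => hterm y₂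
    _ = (∑ y₂ : g.Site, Real.exp (-(δ / 2 * g.dist y₁ y₂))) * Real.exp (-(δ * g.dist y₁ b)) := by rw [Finset.sum_mul]
    _ ≤ c * Real.exp (-(δ * g.dist y₁ b)) :=
        mul_le_mul_of_nonneg_right (sum_exp_le_of_rate (by linarith) hd hsum y₁) (Real.exp_nonneg _)

/-- **THE RESOLVENT ENGINE WITH SCALE WEIGHTS** — see the module docstring.  [cite: Balaban1985BackgroundPropagators, Thm 3.14 (3.154) pp.426–427 (bookkeeping: the resolvent route with the (3.42) prefactors); Balaban1984PropagatorsII, (2.54)–(2.55) pp.232–233, (2.60)–(2.61) p.234] -/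
theorem hasMajorant_resolvent_weighted (blk : X → g.Site) (hd : ∀ a b : g.Site, 0 ≤ g.dist a b) (htri : Triangle254 g)
    {δ c C₁ C₂ v Λ : ℝ} (hδ : 0 ≤ δ) (hc : 0 ≤ c) (hC₁ : 0 ≤ C₁) (hC₂ : 0 ≤ C₂) (hv : 0 ≤ v) (hΛ : 0 ≤ Λ)
    (hsum : ∀ y : g.Site, ∑ y' : g.Site, Real.exp (-(δ / 6 * g.dist y y')) ≤ c)
    (S : Set g.Site) (F : g.Site → g.Site → ℝ) (hF : ∀ a b y₁ : g.Site, y₁ ∈ S → F a b ≤ g.dist a y₁ + g.dist y₁ b)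
    (w₁ u w₂ r W : g.Site → ℝ) (hw₁ : ∀ y, 0 ≤ w₁ y) (hu : ∀ y, 0 ≤ u y) (hr : ∀ y, 0 ≤ r y)
    (hW : ∀ y, 0 ≤ W y)
    (htr : ∀ a y₁ y₂ : g.Site,
      u y₁ * w₂ y₂ * Real.exp (-(δ / 2 * g.dist a y₁)) * Real.exp (-(δ / 2 * g.dist y₁ y₂)) ≤ Λ * W a)
    {T₁ V T₂ : Module.End ℝ (X → ℝ)} {K₁ KV K₂ : g.Site → g.Site → ℝ}
    (h₁ : HasMajorant blk T₁ K₁) (hV : HasMajorant blk V KV) (h₂ : HasMajorant blk T₂ K₂)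
    (hKV0 : ∀ a b, 0 ≤ KV a b) (hK₂0 : ∀ a b, 0 ≤ K₂ a b)
    (hK₁ : ∀ a y : g.Site, K₁ a y ≤ C₁ * w₁ a * Real.exp (-(δ * g.dist a y)))
    (hKV : ∀ y₁ y₂ : g.Site, KV y₁ y₂ ≤ v * u y₁ * Real.exp (-(2 * δ * g.dist y₁ y₂)))
    (hKVS : ∀ y₁ y₂ : g.Site, y₁ ∉ S → KV y₁ y₂ = 0)
    (hK₂ : ∀ y b : g.Site, K₂ y b ≤ C₂ * w₂ y * r b * Real.exp (-(δ * g.dist y b))) :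
    HasMajorant blk (T₁ * V * T₂)
      (fun a b => C₁ * v * C₂ * Λ * c * c * w₁ a * W a * r b * Real.exp (-(δ / 6 * g.dist a b)) *
        Real.exp (-(δ / 6 * F a b))) := by
  refine hasMajorant_mono blk (hasMajorant_mul₃ blk h₁ hV h₂ hKV0 hK₂0) fun a b => ?_
  set E : ℝ := Real.exp (-(δ / 6 * g.dist a b)) * Real.exp (-(δ / 6 * F a b)) with hE
  have hE0 : 0 ≤ E := mul_nonneg (Real.exp_nonneg _) (Real.exp_nonneg _)
  -- the constant in front of the `y₁`-sum
  have hP : 0 ≤ C₁ * v * C₂ * Λ * c * w₁ a * W a * r b :=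
    mul_nonneg (mul_nonneg (mul_nonneg (mul_nonneg (mul_nonneg (mul_nonneg (mul_nonneg hC₁ hv) hC₂) hΛ) hc) (hw₁ a))
      (hW a)) (hr b)
  have step : ∀ y₁ : g.Site, ∑ y₂ : g.Site, K₁ a y₁ * KV y₁ y₂ * K₂ y₂ b ≤
      C₁ * v * C₂ * Λ * c * w₁ a * W a * r b * E * Real.exp (-(δ / 6 * g.dist a y₁)) := by
    intro y₁
    by_cases hy : y₁ ∈ S
    · -- (1) termwise product bound
      have t1 : ∀ y₂ : g.Site, K₁ a y₁ * KV y₁ y₂ * K₂ y₂ b ≤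
          C₁ * w₁ a * Real.exp (-(δ * g.dist a y₁)) * (v * u y₁ * Real.exp (-(2 * δ * g.dist y₁ y₂))) *
            (C₂ * w₂ y₂ * r b * Real.exp (-(δ * g.dist y₂ b))) := fun y₂ =>
        mul_le_mul (mul_le_mul (hK₁ a y₁) (hKV y₁ y₂) (hKV0 _ _)
          (mul_nonneg (mul_nonneg hC₁ (hw₁ a)) (Real.exp_nonneg _))) (hK₂ y₂ b) (hK₂0 _ _)
          (mul_nonneg (mul_nonneg (mul_nonneg hC₁ (hw₁ a)) (Real.exp_nonneg _))
            (mul_nonneg (mul_nonneg hv (hu y₁)) (Real.exp_nonneg _)))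
      -- (2) split the rates and move the middle weights to `a` by the transfer hypothesis
      have t2 : ∀ y₂ : g.Site,
          C₁ * w₁ a * Real.exp (-(δ * g.dist a y₁)) * (v * u y₁ * Real.exp (-(2 * δ * g.dist y₁ y₂))) *
            (C₂ * w₂ y₂ * r b * Real.exp (-(δ * g.dist y₂ b))) ≤
          C₁ * v * C₂ * Λ * w₁ a * W a * r b *
            (Real.exp (-(δ / 2 * g.dist a y₁)) * (Real.exp (-(3 * δ / 2 * g.dist y₁ y₂)) * Real.exp (-(δ * g.dist y₂ b)))) := by
        intro y₂
        have s1 : Real.exp (-(δ * g.dist a y₁)) = Real.exp (-(δ / 2 * g.dist a y₁)) * Real.exp (-(δ / 2 * g.dist a y₁)) := by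
          rw [← Real.exp_add]; ring_nf
        have s2 : Real.exp (-(2 * δ * g.dist y₁ y₂)) =
            Real.exp (-(δ / 2 * g.dist y₁ y₂)) * Real.exp (-(3 * δ / 2 * g.dist y₁ y₂)) := by
          rw [← Real.exp_add]; ring_nf
        rw [s1, s2]
        have hrest : 0 ≤ C₁ * v * C₂ * w₁ a * r b *
            (Real.exp (-(δ / 2 * g.dist a y₁)) * (Real.exp (-(3 * δ / 2 * g.dist y₁ y₂)) * Real.exp (-(δ * g.dist y₂ b)))) :=
          mul_nonneg (mul_nonneg (mul_nonneg (mul_nonneg (mul_nonneg hC₁ hv) hC₂) (hw₁ a)) (hr b))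
            (mul_nonneg (Real.exp_nonneg _) (mul_nonneg (Real.exp_nonneg _) (Real.exp_nonneg _)))
        have key := mul_le_mul_of_nonneg_left (htr a y₁ y₂) hrest
        calc C₁ * w₁ a * (Real.exp (-(δ / 2 * g.dist a y₁)) * Real.exp (-(δ / 2 * g.dist a y₁))) *
              (v * u y₁ * (Real.exp (-(δ / 2 * g.dist y₁ y₂)) * Real.exp (-(3 * δ / 2 * g.dist y₁ y₂)))) *
              (C₂ * w₂ y₂ * r b * Real.exp (-(δ * g.dist y₂ b)))
            = C₁ * v * C₂ * w₁ a * r b *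
                (Real.exp (-(δ / 2 * g.dist a y₁)) * (Real.exp (-(3 * δ / 2 * g.dist y₁ y₂)) * Real.exp (-(δ * g.dist y₂ b)))) *
                (u y₁ * w₂ y₂ * Real.exp (-(δ / 2 * g.dist a y₁)) * Real.exp (-(δ / 2 * g.dist y₁ y₂))) := by ring
          _ ≤ C₁ * v * C₂ * w₁ a * r b *
                (Real.exp (-(δ / 2 * g.dist a y₁)) * (Real.exp (-(3 * δ / 2 * g.dist y₁ y₂)) * Real.exp (-(δ * g.dist y₂ b)))) *
                (Λ * W a) := key
          _ = C₁ * v * C₂ * Λ * w₁ a * W a * r b *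
                (Real.exp (-(δ / 2 * g.dist a y₁)) * (Real.exp (-(3 * δ / 2 * g.dist y₁ y₂)) * Real.exp (-(δ * g.dist y₂ b)))) := by
              ring
      -- (3) sum over `y₂`
      have hQ : 0 ≤ C₁ * v * C₂ * Λ * w₁ a * W a * r b * Real.exp (-(δ / 2 * g.dist a y₁)) :=
        mul_nonneg (mul_nonneg (mul_nonneg (mul_nonneg (mul_nonneg (mul_nonneg (mul_nonneg hC₁ hv) hC₂) hΛ) (hw₁ a)) (hW a))
          (hr b)) (Real.exp_nonneg _)
      have hsum₁ : ∑ y₂ : g.Site, K₁ a y₁ * KV y₁ y₂ * K₂ y₂ b ≤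
          C₁ * v * C₂ * Λ * w₁ a * W a * r b * Real.exp (-(δ / 2 * g.dist a y₁)) *
            ∑ y₂ : g.Site, Real.exp (-(3 * δ / 2 * g.dist y₁ y₂)) * Real.exp (-(δ * g.dist y₂ b)) := by
        rw [Finset.mul_sum]
        refine Finset.sum_le_sum fun y₂ _ => ((t1 y₂).trans (t2 y₂)).trans (le_of_eq ?_)
        ring
      have hin := inner_sum_le hδ hd htri hsum y₁ b
      -- (4) the exponent bookkeeping: (δ/2)d(a,y₁) + δd(y₁,b) ≥ (δ/6)(d(a,b) + F(a,b) + d(a,y₁))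
      have hexp : Real.exp (-(δ / 2 * g.dist a y₁)) * Real.exp (-(δ * g.dist y₁ b)) ≤ E * Real.exp (-(δ / 6 * g.dist a y₁)) := by
        rw [hE, ← Real.exp_add, ← Real.exp_add, ← Real.exp_add]
        apply Real.exp_le_exp.2
        have hab := htri a y₁ b
        have hFab := hF a b y₁ hy
        have hq := hd y₁ b
        have hp := hd a y₁
        have h3 : δ / 6 * (g.dist a b + F a b + g.dist a y₁) ≤ δ / 6 * (3 * (g.dist a y₁ + g.dist y₁ b)) :=
          mul_le_mul_of_nonneg_left (by linarith) (by linarith)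
        have h4 : 0 ≤ δ * g.dist y₁ b := mul_nonneg hδ hq
        linarith
      calc ∑ y₂ : g.Site, K₁ a y₁ * KV y₁ y₂ * K₂ y₂ b
          ≤ C₁ * v * C₂ * Λ * w₁ a * W a * r b * Real.exp (-(δ / 2 * g.dist a y₁)) * (c * Real.exp (-(δ * g.dist y₁ b))) :=
            hsum₁.trans (mul_le_mul_of_nonneg_left hin hQ)
        _ = C₁ * v * C₂ * Λ * c * w₁ a * W a * r b * (Real.exp (-(δ / 2 * g.dist a y₁)) * Real.exp (-(δ * g.dist y₁ b))) := by
            ring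
        _ ≤ C₁ * v * C₂ * Λ * c * w₁ a * W a * r b * (E * Real.exp (-(δ / 6 * g.dist a y₁))) :=
            mul_le_mul_of_nonneg_left hexp hP
        _ = C₁ * v * C₂ * Λ * c * w₁ a * W a * r b * E * Real.exp (-(δ / 6 * g.dist a y₁)) := by ring
    · have h0 : ∀ y₂ : g.Site, K₁ a y₁ * KV y₁ y₂ * K₂ y₂ b = 0 := fun y₂ => by rw [hKVS y₁ y₂ hy, mul_zero, zero_mul]
      simp only [h0, Finset.sum_const_zero]
      exact mul_nonneg (mul_nonneg hP hE0) (Real.exp_nonneg _)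
  calc ∑ y₁ : g.Site, ∑ y₂ : g.Site, K₁ a y₁ * KV y₁ y₂ * K₂ y₂ b
      ≤ ∑ y₁ : g.Site, C₁ * v * C₂ * Λ * c * w₁ a * W a * r b * E * Real.exp (-(δ / 6 * g.dist a y₁)) :=
        Finset.sum_le_sum fun y₁ _ => step y₁
    _ = C₁ * v * C₂ * Λ * c * w₁ a * W a * r b * E * ∑ y₁ : g.Site, Real.exp (-(δ / 6 * g.dist a y₁)) := by
        rw [Finset.mul_sum]
    _ ≤ C₁ * v * C₂ * Λ * c * w₁ a * W a * r b * E * c := mul_le_mul_of_nonneg_left (hsum a) (mul_nonneg hP hE0)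
    _ = C₁ * v * C₂ * Λ * c * c * w₁ a * W a * r b * Real.exp (-(δ / 6 * g.dist a b)) * Real.exp (-(δ / 6 * F a b)) := by
        rw [hE]; ring

/-- **The weighted resolvent route to Theorem 3.14's sup entry**: `T₁ − T₂ = T₁(A₂ − A₁)T₂` (`T₁A₁ = 1`, `A₂T₂ = 1`) has the majorant of
`hasMajorant_resolvent_weighted`. [cite: Balaban1985BackgroundPropagators, Thm 3.14 (3.154) pp.426–427 (bookkeeping: the resolvent route with prefactors)] -/
theorem hasMajorant_inv_sub_inv_weighted (blk : X → g.Site) (hd : ∀ a b : g.Site, 0 ≤ g.dist a b) (htri : Triangle254 g)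
    {δ c C₁ C₂ v Λ : ℝ} (hδ : 0 ≤ δ) (hc : 0 ≤ c) (hC₁ : 0 ≤ C₁) (hC₂ : 0 ≤ C₂) (hv : 0 ≤ v) (hΛ : 0 ≤ Λ)
    (hsum : ∀ y : g.Site, ∑ y' : g.Site, Real.exp (-(δ / 6 * g.dist y y')) ≤ c)
    (S : Set g.Site) (F : g.Site → g.Site → ℝ) (hF : ∀ a b y₁ : g.Site, y₁ ∈ S → F a b ≤ g.dist a y₁ + g.dist y₁ b)
    (w₁ u w₂ r W : g.Site → ℝ) (hw₁ : ∀ y, 0 ≤ w₁ y) (hu : ∀ y, 0 ≤ u y) (hr : ∀ y, 0 ≤ r y)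
    (hW : ∀ y, 0 ≤ W y)
    (htr : ∀ a y₁ y₂ : g.Site,
      u y₁ * w₂ y₂ * Real.exp (-(δ / 2 * g.dist a y₁)) * Real.exp (-(δ / 2 * g.dist y₁ y₂)) ≤ Λ * W a)
    {T₁ T₂ A₁ A₂ : Module.End ℝ (X → ℝ)} (hinv₁ : T₁ * A₁ = 1) (hinv₂ : A₂ * T₂ = 1) {K₁ KV K₂ : g.Site → g.Site → ℝ}
    (h₁ : HasMajorant blk T₁ K₁) (hV : HasMajorant blk (A₂ - A₁) KV) (h₂ : HasMajorant blk T₂ K₂)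
    (hKV0 : ∀ a b, 0 ≤ KV a b) (hK₂0 : ∀ a b, 0 ≤ K₂ a b)
    (hK₁ : ∀ a y : g.Site, K₁ a y ≤ C₁ * w₁ a * Real.exp (-(δ * g.dist a y)))
    (hKV : ∀ y₁ y₂ : g.Site, KV y₁ y₂ ≤ v * u y₁ * Real.exp (-(2 * δ * g.dist y₁ y₂)))
    (hKVS : ∀ y₁ y₂ : g.Site, y₁ ∉ S → KV y₁ y₂ = 0)
    (hK₂ : ∀ y b : g.Site, K₂ y b ≤ C₂ * w₂ y * r b * Real.exp (-(δ * g.dist y b))) :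
    HasMajorant blk (T₁ - T₂)
      (fun a b => C₁ * v * C₂ * Λ * c * c * w₁ a * W a * r b * Real.exp (-(δ / 6 * g.dist a b)) *
        Real.exp (-(δ / 6 * F a b))) := by
  rw [sub_eq_mul_sub_mul hinv₁ hinv₂]
  exact hasMajorant_resolvent_weighted blk hd htri hδ hc hC₁ hC₂ hv hΛ hsum S F hF w₁ u w₂ r W hw₁ hu hr hW htr h₁ hV h₂ hKV0
    hK₂0 hK₁ hKV hKVS hK₂

end Weighted

end Literature.MathematicalPhysics.QuantumFieldTheory.Balaban1983to89.B9Thm314ResolventWeighted
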